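import Summits.QuantumFields.YangMills.Theorems.BalabanUVNodesN15KingModelFullPropagatorBgLetters
import Summits.QuantumFields.YangMills.Theorems.BalabanUVNodesN15KingModelFullPropagatorAdjGradHolderOperator
import Summits.QuantumFields.YangMills.Theorems.BalabanUVNodesN15BackgroundByPartsNode
import Summits.QuantumFields.YangMills.Theorems.BalabanUVNodesN15BackwardShift
import Summits.QuantumFields.YangMills.Theorems.BalabanUVNodesN15FullPropagatorEntry2Rows

/-!
# BalabanUVNodes ∕ N15 — THE KING-MODEL RUNG, PART Σ-c: THE EXTRA `U ≡ 1` LETTERS dag-n15-c's BY-PARTS FIRST-ORDER DEVICE DISPLAYS, FOR KING's FULL `A = 0`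
# PROPAGATOR — King's point pairing one step forward, the shift costs, the defect of the two forward shifts, and ★ THE SHIFT-DEFECT ROW LETTER from the
# one-step Hölder modulus of `A₀⁻¹∇*` (part W-b)
# (Track A, DAG node N15 = NE2; FAN-OUT v1.1 §N15 s3 «KING-MODEL ∕ RIEMANN-KERNEL RUNG»; the joint -e∕-c knit, letters half)

HONEST FRAMING.  Count-neutral KNIT plumbing (cell `pub-ymgap`, seat `pub-ymgap-dag-n15-e` g11; `--supports stmt-QuantumFields-20544 --as helper` = K3⁷
`SpineGivenEndpointR13SepCoPH`).  No new estimate: the analytic inputs are part Ψ-e (plain letters, via part Σ-a), part W-b `fullPropAdjOp_holder_le` ([B9] (3.43)₂ at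
`U ≡ 1`: the Hölder modulus of `A₀⁻¹∇*_νλ`) and part R `one_le_tdistT_of_ne`; everything else is the lattice bookkeeping of dag-n15-c's by-parts device
(`BackgroundLayer.ne2PlusOperator_byParts`, FILE 7b) transported from the bond lattice ∕ `kingPrV` of the torus family of record to the rung's SITE lattice
`Tor (fine N M)` ∕ King's point pairing `underPtN` (template: dag-n15-c `…N15FullPropagatorEntry2Rows` §3–§4 for Bałaban's Landau-gauge `gOp`).
TEMPLATE LITERATURE, `A = 0`: C. King's scalar U(1)-Higgs MODEL ([King1986] (2.13) p. 653), NOT Bałaban's covariant `G(U)`.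
* §1 `underPtN_eq_kingPr` (the rung's pairing IS dag-n15-a's `kingPr`), `underPtN_add_unitVec` (one step forward: same coarse point, or the next one on the upper face);
  `add_unitVec_ne`, `blockOf_comp_underPtN`.
* §2 THE DEVICE: `idef_shiftT_apply`, ★ `hasMaj_idefShiftT_comp` — through King's point pairing the defect of the two forward shifts `𝔇(S′_{+κ}, S_{+κ})∘T` has every block
  majorant that the one-step forward difference `(S_{+κ} − 1)∘T` has (it VANISHES on the upper `κ`-face and is minus the one-step difference inside).
* §3 shift costs: `hasMaj_shiftT_comp`, `hasMaj_shiftT` (`S_{+κ} ≤ e^{ρ}e^{−ρ|y−y′|_T}` between the sharp unit-block sizes, any fineness `N`).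
* §4 `hasMaj_oneStepFwd_kingSOp` (`(S_{+κ} − 1)∘A₀⁻¹N∇*_ν ≤ C(L^K)^{−α}e^{−δ|y−y′|_T}`, `0 < α < 1` — part W-b at one lattice step), ★★ **`hasMaj_shiftDefect_kingS`** — THE
  SHIFT-DEFECT ROW LETTER at King's full propagator: for every coefficient operator `C_a` intertwining the coarse shift (`S_{+κ}C_a = C_a⁺S_{+κ}`, `C_a ≤ diagK a₀`,
  `C_a⁺ − C_a ≤ diagK o₁`), `𝔇(S′_{+κ}, S_{+κ})∘(C_a∘Σ_ν(A₀⁻¹N∇*_ν)pr_ν) ≤ C·(o₁ + a₀(L^K)^{−α})·e^{−δ|y−y′|_T}` from the lifted block size of `X × J` to the fine one.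
The sequel (part Σ-d) plugs §3–§4 + part Σ-a into FILE 7b.  NE2⁺ NOT PRINTED ∕ not proved; N15 NOT discharged; count-neutral; nothing continuum ∕ ℝ⁴ ∕ OS ∕ mass-gap ∕
Clay.  0 `sorry`, 0 `def`, standard axioms.  HONEST SCOPE: `A = 0`, periodic b.c., odd `L ≥ 3`, cubes `2L^e`, `K ≥ 1`, `0 < m² ≤ m₀²`, `0 < α < 1`; sharp block sup sizes;
King's spelling; not Bałaban's `G(U)`; not a discharge.
Locators: [Balaban1985BackgroundPropagators] Thm 3.1 (3.42)–(3.43) pp. 397–398, (3.64)–(3.65) p. 402 (mechanism); [King1986] (2.13) p. 653, p. 664 (pairing), Prop. 3.9 (3.73)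
p. 665; [Balaban1984PropagatorsI] Prop. 1.2 (1.110)–(1.111) p. 35 (shape of the Hölder step).
-/

noncomputable section

namespace Summit.QuantumFields.YangMills.BalabanUVNodes.N15KingModelRung.Curved

open Real Finset Matrix
open Literature.MathematicalPhysics.QuantumFieldTheory.Balaban1983to89
open Literature.MathematicalPhysics.QuantumFieldTheory.Balaban1983to89.B11SectG (BlockNorm HasMaj)
open Literature.MathematicalPhysics.QuantumFieldTheory.Balaban1983to89.B11AxialTransport190 (abs_le_loc_ofBlocks loc_ofBlocks_le)
open Literature.MathematicalPhysics.QuantumFieldTheory.Balaban1983to89.B9Eq3130MatrixLetters (hasMaj_id_ofBlocks)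
open Literature.MathematicalPhysics.QuantumFieldTheory.Balaban1983to89.T4EtaRateDefect (idef idef_apply)
open Literature.MathematicalPhysics.QuantumFieldTheory.Balaban1983to89.T4EtaRateCoeffDefect (pull pull_apply diagK)
open Literature.MathematicalPhysics.QuantumFieldTheory.Balaban1983to89.B5Prop11Plancherel (Tor fine unitVec)
open Literature.MathematicalPhysics.QuantumFieldTheory.King1986 (aK)
open Literature.MathematicalPhysics.QuantumFieldTheory.King1986.Torus (fineOp blockOf tdistT tdistT_nonneg tdistT_symm tdistT_triangle tdistT_self
  tdistT_add_unitVec_le)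
open Summit.QuantumFields.YangMills.BalabanUVNodes.N15.VectorPiece (unitTorusGeoS kingPr kingPr_val kingPr_add_unitVec tdistT_blockOf_sub_unitVec_le)
open Summit.QuantumFields.YangMills.BalabanUVNodes.N15.MatrixSpecies (liftBlk)
open Summit.QuantumFields.YangMills.BalabanUVNodes.N15.BackgroundLayer (sumJ fgradAdj fgradAdj_apply hasMaj_sumJ_exp comp_sumJ sub_id_comp_comp_eq
  tdistT_blockOf_add_unitVec_le)
open Summit.QuantumFields.YangMills.BalabanUVNodes.N15.SiteLayer (hasMaj_diagK_comp_exp hasMaj_add_exp)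

variable {d : ℕ} (L : ℕ) [NeZero L]

/-! ## §1 King's point pairing one step forward -/

section Pairing

variable (K n : ℕ) (M : Fin (d + 1) → ℕ) [∀ μ, NeZero (M μ)]

/-- The rung's pairing `underPtN` (parts F₀ ∕ CurvedHTorus) IS dag-n15-a's `kingPr` (both read `x_μ = ⌊x′_μ∕L^n⌋`). [cite: King1986, p.664 (pairing convention)] -/
theorem underPtN_eq_kingPr : underPtN L K n M = kingPr L K n M := by
  funext x' μ
  apply ZMod.val_injective
  rw [val_underPtN, kingPr_val]

/-- ONE STEP FORWARD UNDER THE PAIRING: `π(x′ + e′_κ)` is `π x′` (inside the fibre) or `π x′ + e_κ` (on the upper `κ`-face). [cite: King1986, p.664 (pairing convention)] -/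
theorem underPtN_add_unitVec (x' : Tor (fine (L ^ n * L ^ K) M)) (κ : Fin (d + 1)) :
    underPtN L K n M (x' + unitVec (fine (L ^ n * L ^ K) M) κ) = underPtN L K n M x' ∨
      underPtN L K n M (x' + unitVec (fine (L ^ n * L ^ K) M) κ) = underPtN L K n M x' + unitVec (fine (L ^ K) M) κ := by
  rw [underPtN_eq_kingPr, kingPr_add_unitVec]
  by_cases h : L ^ n ∣ (x' κ).val + 1
  · rw [if_pos h]; exact Or.inr rfl
  · rw [if_neg h]; exact Or.inl rfl

omit [NeZero L] [∀ μ, NeZero (M μ)] in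
/-- A unit step moves the point (the fine periods are `≥ 2`). [folklore] -/
theorem add_unitVec_ne (N : ℕ) [NeZero N] (hN : ∀ μ, 2 ≤ fine N M μ) (x : Tor (fine N M)) (κ : Fin (d + 1)) :
    x + unitVec (fine N M) κ ≠ x := by
  intro h
  have h1 : unitVec (fine N M) κ κ = 0 := by
    have := congrFun h κ
    simpa using this
  have h2 : (unitVec (fine N M) κ κ : ZMod (fine N M κ)) = 1 := by simp [unitVec]
  rw [h2] at h1
  haveI : Fact (1 < fine N M κ) := ⟨hN κ⟩
  exact one_ne_zero h1

/-- The fine blocking through the pairing IS the fine lattice's own blocking. [cite: King1986, p.664 (pairing convention)] -/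
theorem blockOf_comp_underPtN : blockOf (L ^ K) M ∘ underPtN L K n M = blockOf (L ^ n * L ^ K) M :=
  funext fun x' => blockOf_underPtN L K n M x'

end Pairing

/-! ## §2 The device: the defect of the two forward shifts through King's point pairing -/

section Device

variable (K n : ℕ) (M : Fin (d + 1) → ℕ) [∀ μ, NeZero (M μ)]

omit [NeZero L] [∀ μ, NeZero (M μ)] in
/-- The defect of the two forward shifts, pointwise: `𝔇(S′_{+κ}, S_{+κ})g(x′) = g(π(x′ + e′_κ)) − g(πx′ + e_κ)`. [folklore] -/
theorem idef_shiftT_apply (κ : Fin (d + 1)) (g : Tor (fine (L ^ K) M) → ℝ) (x' : Tor (fine (L ^ n * L ^ K) M)) :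
    idef (pull (underPtN L K n M)) (pull (underPtN L K n M)) (pull ⇑(Equiv.addRight (unitVec (fine (L ^ n * L ^ K) M) κ)))
      (pull ⇑(Equiv.addRight (unitVec (fine (L ^ K) M) κ))) g x' =
      g (underPtN L K n M (x' + unitVec (fine (L ^ n * L ^ K) M) κ)) - g (underPtN L K n M x' + unitVec (fine (L ^ K) M) κ) := rfl

/-- ★ **THE DEFECT OF THE TWO FORWARD SHIFTS IS MAJORISED BY THE ONE-STEP FORWARD DIFFERENCE** (site twin of dag-n15-c's `hasMaj_idefFShift_comp`): through King's point pairing,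
`𝔇(S′_{+κ}, S_{+κ})∘T` has every block majorant `K ≥ 0` that `(S_{+κ} − 1)∘T` has — the defect VANISHES on the upper `κ`-face of the fibre and is minus the one-step forward
difference inside it. [cite: King1986, p.664 (pairing convention: the mechanism)] -/
theorem hasMaj_idefShiftT_comp {Msz : ℝ} {F₁ : Type} [AddCommGroup F₁] [Module ℝ F₁] {b₁ : BlockNorm (unitTorusGeoS L K M Msz) F₁}
    {T : F₁ →ₗ[ℝ] (Tor (fine (L ^ K) M) → ℝ)} {Kf : Tor M → Tor M → ℝ} (hK : ∀ y y', 0 ≤ Kf y y') (κ : Fin (d + 1))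
    (h : HasMaj b₁ (BlockNorm.ofBlocks (unitTorusGeoS L K M Msz) (blockOf (L ^ K) M))
      ((pull ⇑(Equiv.addRight (unitVec (fine (L ^ K) M) κ)) - LinearMap.id) ∘ₗ T) Kf) :
    HasMaj b₁ (BlockNorm.ofBlocks (unitTorusGeoS L K M Msz) (blockOf (L ^ K) M ∘ underPtN L K n M))
      (idef (pull (underPtN L K n M)) (pull (underPtN L K n M)) (pull ⇑(Equiv.addRight (unitVec (fine (L ^ n * L ^ K) M) κ)))
        (pull ⇑(Equiv.addRight (unitVec (fine (L ^ K) M) κ))) ∘ₗ T) Kf := by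
  intro y' μ hμ y
  refine loc_ofBlocks_le (g := unitTorusGeoS L K M Msz) _ _ (mul_nonneg (hK y y') (b₁.loc_nonneg y' μ)) fun x' hx' => ?_
  rw [LinearMap.comp_apply, idef_shiftT_apply]
  rcases underPtN_add_unitVec L K n M x' κ with hc | hc
  · -- inside the fibre: minus the one-step forward difference at the paired point
    rw [hc]
    have hval : T μ (underPtN L K n M x') - T μ (underPtN L K n M x' + unitVec (fine (L ^ K) M) κ) =
        -((((pull ⇑(Equiv.addRight (unitVec (fine (L ^ K) M) κ)) - LinearMap.id) ∘ₗ T : F₁ →ₗ[ℝ] (Tor (fine (L ^ K) M) → ℝ)) μ)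
          (underPtN L K n M x')) := by
      rw [LinearMap.comp_apply, LinearMap.sub_apply, Pi.sub_apply, pull_apply, Equiv.coe_addRight, LinearMap.id_apply, neg_sub]
    rw [hval, abs_neg]
    have hx : blockOf (L ^ K) M (underPtN L K n M x') = y := hx'
    exact (abs_le_loc_ofBlocks (g := unitTorusGeoS L K M Msz) (blockOf (L ^ K) M) _ hx).trans (h y' μ hμ y)
  · -- on the upper face: the two shifts are paired, the defect vanishes
    rw [hc, sub_self, abs_zero]
    exact mul_nonneg (hK y y') (b₁.loc_nonneg y' μ)

end Device

/-! ## §3 The shift costs -/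

section Shift

variable (K N : ℕ) [NeZero N] (M : Fin (d + 1) → ℕ) [∀ μ, NeZero (M μ)] (Msz : ℝ)

omit [NeZero L] in
/-- Composing with the forward shift costs `e^{ρ}`: `S_{+κ}∘T ≤ B·e^{ρ}·e^{−ρ|y−y′|_T}` if `T ≤ B·e^{−ρ|y−y′|_T}` (the shifted point lies in the same or an adjacent unit block).
[cite: King1986, p.664 (unit blocks)] -/
theorem hasMaj_shiftT_comp {F₁ : Type} [AddCommGroup F₁] [Module ℝ F₁] {b₁ : BlockNorm (unitTorusGeoS L K M Msz) F₁} {T : F₁ →ₗ[ℝ] (Tor (fine N M) → ℝ)}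
    {B ρ : ℝ} (hB : 0 ≤ B) (hρ : 0 ≤ ρ) (κ : Fin (d + 1))
    (h : HasMaj b₁ (BlockNorm.ofBlocks (unitTorusGeoS L K M Msz) (blockOf N M)) T (fun y y' => B * Real.exp (-(ρ * tdistT M y y')))) :
    HasMaj b₁ (BlockNorm.ofBlocks (unitTorusGeoS L K M Msz) (blockOf N M)) (pull ⇑(Equiv.addRight (unitVec (fine N M) κ)) ∘ₗ T)
      (fun y y' => B * Real.exp ρ * Real.exp (-(ρ * tdistT M y y'))) := by
  intro y' μ hμ y
  refine loc_ofBlocks_le (g := unitTorusGeoS L K M Msz) _ _ (mul_nonneg (by positivity) (b₁.loc_nonneg y' μ)) fun x hx => ?_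
  rw [LinearMap.comp_apply, pull_apply, Equiv.coe_addRight]
  -- the shifted point lies in the block `y₁ := B(x + e_κ)`, at distance `≤ 1` from `y = B(x)`
  set y₁ := blockOf N M (x + unitVec (fine N M) κ) with hy₁
  have h1 : |T μ (x + unitVec (fine N M) κ)| ≤ B * Real.exp (-(ρ * tdistT M y₁ y')) * b₁.loc y' μ :=
    (abs_le_loc_ofBlocks (g := unitTorusGeoS L K M Msz) (blockOf N M) _ rfl).trans (h y' μ hμ y₁)
  have hd : tdistT M y y' ≤ tdistT M y₁ y' + 1 := by
    have h2 : tdistT M y y₁ ≤ 1 := by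
      rw [← hx, hy₁, tdistT_symm]
      exact tdistT_blockOf_add_unitVec_le M N x κ
    linarith [tdistT_triangle M y y₁ y']
  refine h1.trans (mul_le_mul_of_nonneg_right ?_ (b₁.loc_nonneg y' μ))
  show B * Real.exp (-(ρ * tdistT M y₁ y')) ≤ B * Real.exp ρ * Real.exp (-(ρ * tdistT M y y'))
  rw [mul_assoc, ← Real.exp_add]
  exact mul_le_mul_of_nonneg_left (Real.exp_le_exp.mpr (by nlinarith)) hB

omit [NeZero L] in
/-- **THE FORWARD SHIFT ITSELF** `S_{+κ} ≤ e^{ρ}·e^{−ρ|y−y′|_T}` between the sharp unit-block sizes (`ρ ≥ 0`), at any fineness. [cite: King1986, p.664 (unit blocks)] -/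
theorem hasMaj_shiftT {ρ : ℝ} (hρ : 0 ≤ ρ) (κ : Fin (d + 1)) :
    HasMaj (BlockNorm.ofBlocks (unitTorusGeoS L K M Msz) (blockOf N M)) (BlockNorm.ofBlocks (unitTorusGeoS L K M Msz) (blockOf N M))
      (pull ⇑(Equiv.addRight (unitVec (fine N M) κ))) (fun y y' => Real.exp ρ * Real.exp (-(ρ * tdistT M y y'))) := by
  have h := hasMaj_shiftT_comp L K N M Msz zero_le_one hρ κ
    (hasMaj_id_ofBlocks (g := unitTorusGeoS L K M Msz) (blockOf N M) (fun y => tdistT_self M y) ρ)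
  rw [LinearMap.comp_id] at h
  exact h.mono fun y y' => le_of_eq (by ring)

end Shift

/-! ## §4 The one-step forward difference of `A₀⁻¹N∇*_ν` and THE SHIFT-DEFECT ROW LETTER at King's full propagator -/

section Row

/-- **THE ONE-STEP FORWARD DIFFERENCE OF `S_ν = A₀⁻¹N∇*_ν` ON THE COARSE RUN**: for odd `L ≥ 3`, `a > 0`, `0 ≤ m₀²`, `0 < α < 1` there are `C, δ > 0` with
`(S_{+κ} − 1)∘S_ν ≤ C·(L^K)^{−α}·e^{−δ|y−y′|_T}` between the sharp unit-block sizes — part W-b `fullPropAdjOp_holder_le` ((3.43)₂ at `U ≡ 1`: the Hölder modulus of `A₀⁻¹∇*_νλ`)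
at one lattice step (`|x − x′| = 1 ≤ N = L^K`; the neighbour block costs `e^{δ}`). [cite: Balaban1985BackgroundPropagators, Thm 3.1 (3.43) p.398 (second half); Balaban1984PropagatorsI, Prop. 1.2 (1.111) p.35 (shape)] -/
theorem hasMaj_oneStepFwd_kingSOp (hLodd : Odd L) (hL : 2 ≤ L) {a : ℝ} (ha : 0 < a) {m0sq : ℝ} (hm0 : 0 ≤ m0sq) {α : ℝ} (hα0 : 0 < α) (hα1 : α < 1) :
    ∃ C δ : ℝ, 0 < C ∧ 0 < δ ∧ ∀ (K : ℕ), 1 ≤ K → ∀ (e : ℕ) (M : Fin (d + 1) → ℕ) [∀ μ, NeZero (M μ)], (∀ μ, M μ = 2 * L ^ e) →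
      ∀ (msq : ℝ), 0 < msq → msq ≤ m0sq → ∀ (Msz : ℝ) (κ ν : Fin (d + 1)),
      HasMaj (BlockNorm.ofBlocks (unitTorusGeoS L K M Msz) (blockOf (L ^ K) M)) (BlockNorm.ofBlocks (unitTorusGeoS L K M Msz) (blockOf (L ^ K) M))
        ((pull ⇑(Equiv.addRight (unitVec (fine (L ^ K) M) κ)) - LinearMap.id) ∘ₗ kingSOp L a msq K (L ^ K) M ν)
        (fun y y' => C * ((L : ℝ) ^ K) ^ (-α) * Real.exp (-(δ * tdistT M y y'))) := by
  obtain ⟨C, δ, hC, hδ, H⟩ := fullPropAdjOp_holder_le (d := d) L hLodd hL ha hm0 hα0 hα1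
  refine ⟨C * Real.exp δ, δ, by positivity, hδ, fun K hK e M _ hM msq hmsq hcap Msz κ ν => ?_⟩
  have hL1 : (1 : ℝ) ≤ (L : ℝ) := by exact_mod_cast (show 1 ≤ L by omega)
  have hN1 : (1 : ℝ) ≤ ((L : ℝ) ^ K) := one_le_pow₀ hL1
  have hNpos : (0 : ℝ) < ((L ^ K : ℕ) : ℝ) := by positivity
  have hθ : 0 ≤ ((L : ℝ) ^ K) ^ (-α) := Real.rpow_nonneg (by positivity) _
  have hfine : ∀ μ, 2 ≤ fine (L ^ K) M μ := fun μ => by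
    show 2 ≤ L ^ K * M μ
    rw [hM μ]
    have h1 : 1 ≤ L ^ K := Nat.one_le_pow _ _ (by omega)
    have h2 : 1 ≤ L ^ e := Nat.one_le_pow _ _ (by omega)
    nlinarith
  refine hasMaj_ofBlocks_of_cubeBound L _ _ _ (mul_nonneg (by positivity) hθ) fun lam F D hF x hD => ?_
  -- the block-distance hypothesis for the shifted point, one unit weaker
  have hD' : ∀ y, lam y ≠ 0 → (D : ℝ) - 1 ≤ tdistT M (blockOf (L ^ K) M (x + unitVec (fine (L ^ K) M) κ)) (blockOf (L ^ K) M y) := fun y hy => by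
    have h1 := hD y hy
    have h2 := tdistT_blockOf_add_unitVec_le M (L ^ K) x κ
    have h3 := tdistT_triangle M (blockOf (L ^ K) M x) (blockOf (L ^ K) M (x + unitVec (fine (L ^ K) M) κ)) (blockOf (L ^ K) M y)
    rw [tdistT_symm] at h2
    linarith
  have hDx : ∀ y, lam y ≠ 0 → (D : ℝ) - 1 ≤ tdistT M (blockOf (L ^ K) M x) (blockOf (L ^ K) M y) := fun y hy => by linarith [hD y hy]
  have key := H K hK (L ^ K) rfl e M hM msq hmsq hcap ν lam F ((D : ℝ) - 1) hF x (x + unitVec (fine (L ^ K) M) κ) hDx hD'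
  -- the distance of the two points is exactly one lattice step: `1 ≤ t ≤ 1`
  set t : ℝ := tdistT (fine (L ^ K) M) x (x + unitVec (fine (L ^ K) M) κ) with ht
  have ht1 : t = 1 := le_antisymm (tdistT_add_unitVec_le (fine (L ^ K) M) x κ)
    (by rw [ht, tdistT_symm]; exact one_le_tdistT_of_ne (fine (L ^ K) M) (add_unitVec_ne M (L ^ K) hfine x κ))
  have hcast : ((L ^ K : ℕ) : ℝ) = (L : ℝ) ^ K := by push_cast; ring
  have hfac : (t / ((L ^ K : ℕ) : ℝ)) ^ (-α) = (((L : ℝ) ^ K) ^ (-α))⁻¹ := by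
    rw [ht1, hcast, one_div, Real.inv_rpow (by positivity)]
  rw [hfac] at key
  have hθpos : 0 < ((L : ℝ) ^ K) ^ (-α) := Real.rpow_pos_of_pos (by positivity) _
  rw [LinearMap.comp_apply, LinearMap.sub_apply, Pi.sub_apply, pull_apply, Equiv.coe_addRight, LinearMap.id_apply, kingSOp_apply, kingSOp_apply]
  rw [inv_mul_le_iff₀ hθpos] at key
  refine key.trans (le_of_eq ?_)
  rw [show Real.exp (-(δ * ((D : ℝ) - 1))) = Real.exp δ * Real.exp (-(δ * D)) by rw [← Real.exp_add]; ring_nf]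
  ring

omit [NeZero L] in
/-- The device's source step IS the rung's: `A₀⁻¹ ∘ fgradAdj N (· + e_ν) = S_ν` (`fgradAdj N e λ = N(λ∘e⁻¹ − λ)`, `(· + e_ν)⁻¹ = (· − e_ν)`). [folklore] -/
theorem kingGOp_comp_fgradAdj (a msq : ℝ) (K N : ℕ) [NeZero N] (M : Fin (d + 1) → ℕ) [∀ μ, NeZero (M μ)] (ν : Fin (d + 1)) :
    kingGOp L a msq K N M ∘ₗ fgradAdj (N : ℝ) (Equiv.addRight (unitVec (fine N M) ν)) = kingSOp L a msq K N M ν := by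
  refine LinearMap.ext fun lam => funext fun x => ?_
  rw [LinearMap.comp_apply, kingGOp_apply, kingSOp_apply]
  congr 1
  funext y
  have hy : (Equiv.addRight (unitVec (fine N M) ν)).symm y = y - unitVec (fine N M) ν :=
    (Equiv.symm_apply_eq _).mpr (by simp)
  rw [fgradAdj_apply, hy]

/-- ★★ **THE SHIFT-DEFECT ROW LETTER AT KING's FULL `A = 0` PROPAGATOR** (the letter `hDSh` of dag-n15-c's `ne2PlusOperator_byParts`; site twin of their
`hasMaj_shiftDefect_fullG` for `gOp`).  For odd `L ≥ 3`, `a > 0`, `0 ≤ m₀²`, `0 < α < 1` there are `δ, C > 0` such that for every `K ≥ 1`, `n`, cube `2L^e`, mass `0 < m² ≤ m₀²`, size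
datum, direction `κ` and every coefficient operator `C_a` on the coarse lattice INTERTWINING the coarse shift — `S_{+κ}∘C_a = C_a⁺∘S_{+κ}` with `C_a ≤ diagK a₀`, `C_a⁺ − C_a ≤ diagK o₁`
(`a₀, o₁ ≥ 0`: the size and the one-coarse-step oscillation of the coefficient) — with `Σ = Σ_ν (A₀⁻¹N∇*_ν) pr_ν` (`∇*_ν = fgradAdj N (· + e_ν)`):
`𝔇(S′_{+κ}, S_{+κ})∘(C_a∘Σ) ≤ C·(o₁ + a₀·(L^K)^{−α})·e^{−δ|y−y′|_T}` from the lifted unit-block size of `X × J` to the fine one.  Content: the defect vanishes on the fibre face and is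
the one-step forward difference inside (§2); `(S_{+κ} − 1)C_aΣ = (C_a⁺ − C_a)S_{+κ}Σ + C_a(S_{+κ} − 1)Σ`; the first term costs the oscillation letter × the plain letter of `S_ν` (Σ-a ⇐ Ψ-e),
the second the Hölder step (`hasMaj_oneStepFwd_kingSOp` ⇐ W-b). [cite: Balaban1985BackgroundPropagators, Thm 3.1 (3.42)–(3.43) pp.397–398, (3.64)–(3.65) p.402 (mechanism); King1986, p.664 (pairing); Balaban1984PropagatorsI, Prop. 1.2 (1.110)–(1.111) p.35 (shape)] -/
theorem hasMaj_shiftDefect_kingS (hLodd : Odd L) (hL : 2 ≤ L) {a : ℝ} (ha : 0 < a) {m0sq : ℝ} (hm0 : 0 ≤ m0sq) {α : ℝ} (hα0 : 0 < α) (hα1 : α < 1) :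
    ∃ δ C : ℝ, 0 < δ ∧ 0 < C ∧ ∀ (K : ℕ), 1 ≤ K → ∀ (n e : ℕ) (M : Fin (d + 1) → ℕ) [∀ μ, NeZero (M μ)], (∀ μ, M μ = 2 * L ^ e) →
      ∀ (msq : ℝ), 0 < msq → msq ≤ m0sq → ∀ (Msz : ℝ) (κ : Fin (d + 1))
      (Ca Cap : (Tor (fine (L ^ K) M) → ℝ) →ₗ[ℝ] (Tor (fine (L ^ K) M) → ℝ)) (a₀ o₁ : ℝ), 0 ≤ a₀ → 0 ≤ o₁ →
      pull ⇑(Equiv.addRight (unitVec (fine (L ^ K) M) κ)) ∘ₗ Ca = Cap ∘ₗ pull ⇑(Equiv.addRight (unitVec (fine (L ^ K) M) κ)) →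
      HasMaj (BlockNorm.ofBlocks (unitTorusGeoS L K M Msz) (blockOf (L ^ K) M)) (BlockNorm.ofBlocks (unitTorusGeoS L K M Msz) (blockOf (L ^ K) M)) Ca
        (diagK fun _ => a₀) →
      HasMaj (BlockNorm.ofBlocks (unitTorusGeoS L K M Msz) (blockOf (L ^ K) M)) (BlockNorm.ofBlocks (unitTorusGeoS L K M Msz) (blockOf (L ^ K) M)) (Cap - Ca)
        (diagK fun _ => o₁) →
      HasMaj (BlockNorm.ofBlocks (unitTorusGeoS L K M Msz) (liftBlk (blockOf (L ^ K) M) (Fin (d + 1))))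
        (BlockNorm.ofBlocks (unitTorusGeoS L K M Msz) (blockOf (L ^ K) M ∘ underPtN L K n M))
        (idef (pull (underPtN L K n M)) (pull (underPtN L K n M)) (pull ⇑(Equiv.addRight (unitVec (fine (L ^ n * L ^ K) M) κ)))
            (pull ⇑(Equiv.addRight (unitVec (fine (L ^ K) M) κ))) ∘ₗ
          (Ca ∘ₗ sumJ fun ν => kingGOp L a msq K (L ^ K) M ∘ₗ fgradAdj ((L ^ K : ℕ) : ℝ) (Equiv.addRight (unitVec (fine (L ^ K) M) ν))))
        (fun y y' => C * (o₁ + a₀ * ((L : ℝ) ^ K) ^ (-α)) * Real.exp (-(δ * tdistT M y y'))) := by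
  obtain ⟨C₁, δ₁, hC₁, hδ₁, HH⟩ := hasMaj_oneStepFwd_kingSOp (d := d) L hLodd hL ha hm0 hα0 hα1
  obtain ⟨C₀, δ₀, hC₀, hδ₀, H0⟩ := hasMaj_kingSOp (d := d) L hLodd hL ha hm0
  set δ : ℝ := min δ₀ δ₁ with hδdef
  have hδ : 0 < δ := lt_min hδ₀ hδ₁
  set C : ℝ := Real.exp δ * ((d + 1 : ℕ) * C₀) + (d + 1 : ℕ) * C₁ with hCdef
  have hC : 0 < C := by positivity
  refine ⟨δ, C, hδ, hC, fun K hK n e M _ hM msq hmsq hcap Msz κ Ca Cap a₀ o₁ ha₀ ho₁ hCaS hCa hOsc => ?_⟩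
  have hrα : 0 ≤ ((L : ℝ) ^ K) ^ (-α) := Real.rpow_nonneg (pow_nonneg (Nat.cast_nonneg _) _) _
  -- the plain letter of the `S_ν` at the common rate, of `Σ`, and of `S_{+κ}Σ`
  have hS : ∀ ν, HasMaj (BlockNorm.ofBlocks (unitTorusGeoS L K M Msz) (blockOf (L ^ K) M)) (BlockNorm.ofBlocks (unitTorusGeoS L K M Msz) (blockOf (L ^ K) M))
      (kingGOp L a msq K (L ^ K) M ∘ₗ fgradAdj ((L ^ K : ℕ) : ℝ) (Equiv.addRight (unitVec (fine (L ^ K) M) ν)))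
      (fun y y' => C₀ * Real.exp (-(δ * tdistT M y y'))) := fun ν => by
    rw [kingGOp_comp_fgradAdj]
    exact hasMaj_exp_weaken L hC₀.le le_rfl (min_le_left δ₀ δ₁) (H0 K hK e M hM msq hmsq hcap Msz ν)
  have hSig := hasMaj_sumJ_exp (g := unitTorusGeoS L K M Msz) (blockOf (L ^ K) M)
    (b₂ := BlockNorm.ofBlocks (unitTorusGeoS L K M Msz) (blockOf (L ^ K) M)) hC₀.le hS
  have hSsig := hasMaj_shiftT_comp L K (L ^ K) M Msz
    (b₁ := BlockNorm.ofBlocks (unitTorusGeoS L K M Msz) (liftBlk (blockOf (L ^ K) M) (Fin (d + 1))))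
    (mul_nonneg (Nat.cast_nonneg _) hC₀.le) hδ.le κ hSig
  -- term A: `(C_a⁺ − C_a) S Σ ≤ o₁·|J|C₀e^{δ}·e^{−δd}`
  have hA := hasMaj_diagK_comp_exp (b₁ := BlockNorm.ofBlocks (unitTorusGeoS L K M Msz) (liftBlk (blockOf (L ^ K) M) (Fin (d + 1))))
    (b₃ := BlockNorm.ofBlocks (unitTorusGeoS L K M Msz) (blockOf (L ^ K) M)) (blockOf (L ^ K) M) ho₁ hOsc hSsig
  -- term B: `C_a (S − 1) Σ ≤ a₀·|J|C₁(L^K)^{−α}·e^{−δd}`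
  have hstep : ∀ ν, HasMaj (BlockNorm.ofBlocks (unitTorusGeoS L K M Msz) (blockOf (L ^ K) M)) (BlockNorm.ofBlocks (unitTorusGeoS L K M Msz) (blockOf (L ^ K) M))
      ((pull ⇑(Equiv.addRight (unitVec (fine (L ^ K) M) κ)) - LinearMap.id) ∘ₗ
        (kingGOp L a msq K (L ^ K) M ∘ₗ fgradAdj ((L ^ K : ℕ) : ℝ) (Equiv.addRight (unitVec (fine (L ^ K) M) ν))))
      (fun y y' => C₁ * ((L : ℝ) ^ K) ^ (-α) * Real.exp (-(δ * tdistT M y y'))) := fun ν => by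
    rw [kingGOp_comp_fgradAdj]
    exact hasMaj_exp_weaken L (mul_nonneg hC₁.le hrα) le_rfl (min_le_right δ₀ δ₁) (HH K hK e M hM msq hmsq hcap Msz κ ν)
  have hSig' := hasMaj_sumJ_exp (g := unitTorusGeoS L K M Msz) (blockOf (L ^ K) M)
    (b₂ := BlockNorm.ofBlocks (unitTorusGeoS L K M Msz) (blockOf (L ^ K) M)) (mul_nonneg hC₁.le hrα) hstep
  have hSig'' := hSig'.congr fun u => (LinearMap.congr_fun (comp_sumJ (pull ⇑(Equiv.addRight (unitVec (fine (L ^ K) M) κ)) - LinearMap.id)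
    (fun ν => kingGOp L a msq K (L ^ K) M ∘ₗ fgradAdj ((L ^ K : ℕ) : ℝ) (Equiv.addRight (unitVec (fine (L ^ K) M) ν)))) u).symm
  have hB := hasMaj_diagK_comp_exp (b₁ := BlockNorm.ofBlocks (unitTorusGeoS L K M Msz) (liftBlk (blockOf (L ^ K) M) (Fin (d + 1))))
    (b₃ := BlockNorm.ofBlocks (unitTorusGeoS L K M Msz) (blockOf (L ^ K) M)) (blockOf (L ^ K) M) ha₀ hCa hSig''
  have hkey : o₁ * (((Fintype.card (Fin (d + 1)) : ℕ) : ℝ) * C₀ * Real.exp δ) + a₀ * (((Fintype.card (Fin (d + 1)) : ℕ) : ℝ) * (C₁ * ((L : ℝ) ^ K) ^ (-α))) ≤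
      C * (o₁ + a₀ * ((L : ℝ) ^ K) ^ (-α)) := by
    rw [Fintype.card_fin, hCdef]
    have h1 : 0 ≤ ((d + 1 : ℕ) : ℝ) * C₁ * o₁ := by positivity
    have h2 : 0 ≤ Real.exp δ * (((d + 1 : ℕ) : ℝ) * C₀) * (a₀ * ((L : ℝ) ^ K) ^ (-α)) := by positivity
    nlinarith
  have hsum := (hasMaj_add_exp hA hB).mono fun y y' => (mul_le_mul_of_nonneg_right hkey (Real.exp_nonneg (-(δ * tdistT M y y'))))
  -- the device: it suffices to majorise `(S_{+κ} − 1) ∘ (C_a ∘ Σ) = (C_a⁺ − C_a)S_{+κ}Σ + C_a(S_{+κ} − 1)Σ`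
  exact hasMaj_idefShiftT_comp L K n M (b₁ := BlockNorm.ofBlocks (unitTorusGeoS L K M Msz) (liftBlk (blockOf (L ^ K) M) (Fin (d + 1))))
    (fun _ _ => mul_nonneg (mul_nonneg hC.le (by positivity)) (Real.exp_nonneg _)) κ
    (hsum.congr fun u => (LinearMap.congr_fun (sub_id_comp_comp_eq _ Ca Cap _ hCaS) u).symm)

end Row

end Summit.QuantumFields.YangMills.BalabanUVNodes.N15KingModelRung.Curved

end
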